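import Summits.AtomisticToContinuum.Crystallization.Theses.SquareWellLayerCake
import Summits.AtomisticToContinuum.Crystallization.Theses.PalmUnimodularRigidity
import Summits.AtomisticToContinuum.Crystallization.Theorems.PalmUnimodularRigidityCruxesToPalmRigidity
import Summits.AtomisticToContinuum.Crystallization.Theorems.PalmUnimodularRigidityShellsToBarlowChart
import Summits.AtomisticToContinuum.Crystallization.Theorems.PalmUnimodularRigidityLayeredLawsSelectHcpDefs
import Summits.AtomisticToContinuum.Crystallization.Theorems.ExcessDecayLiouvilleCoarseGrainsHcpEnergySeries
import Summits.AtomisticToContinuum.Crystallization.Theorems.PalmUnimodularRigidityCrysPeriodicBddBelow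
import Summits.AtomisticToContinuum.Crystallization.Theorems.SquareWellLayerCakeTwelveWithinOneBsLimitAlong
import Summits.AtomisticToContinuum.Crystallization.Theorems.SquareWellLayerCakeTwelveWithinOneHcpRootGeometry
import Summits.AtomisticToContinuum.Crystallization.Theorems.SquareWellLayerCakeTwelveWithinOneReturn
import Summits.AtomisticToContinuum.Crystallization.Theorems.SquareWellLayerCakeTwelveWithinOneHcpCellCertificate

/-!
# `TwelveWithinOne` (K2 of route `SquareWellLayerCake`, stmt-AtomisticToContinuum-15808) FROM THE TWO SHARED OPEN
# CRUXES OF THE SUB-PROBLEM — the line `Sketch` closed modulo `MinimiserShells ∧ LayeredLawsSelectHcp`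

`twelveWithinOne_of_palmCruxes : MinimiserShells → LayeredLawsSelectHcp → TwelveWithinOne` (items
stmt-AtomisticToContinuum-9225 and -9226 of route `PalmUnimodularRigidity`, both OPEN; everything else PROVED):

* `stub_bsLimitAlong` (LANDED, `…TwelveWithinOneBsLimitAlong`): the Benjamini–Schramm limit of Lennard-Jones ground
  states along a PRESCRIBED subsequence (item 9230 with the extraction inside the subsequence);
* `PalmRigidity` from the two cruxes and the landed chart + glue (`ShellsToBarlowChart_of`, 9227;
  `cruxesToPalmRigidity_proof`, 9228): a minimising point-stationary hard-core law is a.s. `count|A(hcpStacking a h)`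
  with `e(hcp a h) = e*`;
* PINNING IS FREE (`hcpE_globalMin_of_energy_eq_eStar`): `e* ≤ e(hcp a' h') = hcpE a' h'` makes `(a, h)` a global
  minimiser of the explicit lattice-sum function `hcpE`;
* `stub_hcpCellCertificate` (LANDED, `…TwelveWithinOneHcpCellCertificate`, certified numerics): every global minimiser
  of `hcpE` has both bond lengths `a`, `√(a²/3+h²)` in `[55/57 + 1/500, 1 − 1/500]`;
* `stub_hcpRootGeometry` (LANDED): K2 with inward slack at the root of a rotated relaxed hcp crystal;
* `stub_return` (LANDED): measure-level K2 with slack + BS limits along subsequences ⇒ the crux (portmanteau with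
  slack, "every subsequence has a sub-subsequence").

So K2 carries no open content beyond the `PalmUnimodularRigidity` cruxes 9225 ∧ 9226: the item closes the day they
close (one line: feed `MinimiserShells_holds`, `LayeredLawsSelectHcp_holds` to `twelveWithinOne_of_palmCruxes`).
Checked skeleton of the line: `Cruxes/TwelveWithinOne/Lines/Sketch.lean`; lead's reasoning: `Cruxes/TwelveWithinOne/PICKED.md`.
-/

noncomputable section

open MeasureTheory Filter Set
open scoped ENNReal Topology

namespace Summit.AtomisticToContinuum.Crystallization.Theorems.SquareWellLayerCakeTwelveWithinOne.Closing

open Literature.MathematicalPhysics.StatisticalMechanics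
open Summit.AtomisticToContinuum.Crystallization.Theses.PalmUnimodularRigidity
  (MinimiserShells LayeredLawsSelectHcp PalmRigidity ShellsToBarlowChart)
open Summit.AtomisticToContinuum.Crystallization.Theorems.PalmUnimodularRigidity.LayeredLawsSelectHcp (hcpE hcpQ)
open Summit.AtomisticToContinuum.Crystallization.Theorems.ExcessDecayLiouvilleCoarseGrains (hcpEnergySeries_of_eq)

/-! The four landed stubs `stub_bsLimitAlong`, `stub_hcpCellCertificate`, `stub_hcpRootGeometry`, `stub_return` of the
parent namespace `…Theorems.SquareWellLayerCakeTwelveWithinOne` are used directly (no restatement). -/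

/-! ## Glue (sorry-free) -/

/-- `e(hcp a h) = hcpE a h` (`a, h ≠ 0`): third clause of the landed series theorem
`hcpEnergySeries_of_eq`. [folklore] -/
theorem hcpE_eq_energyPerParticle {a h : ℝ} (ha : a ≠ 0) (hh : h ≠ 0) :
    hcpE a h = (hcpPeriodicConfiguration ha hh).energyPerParticle lennardJones :=
  ((hcpEnergySeries_of_eq a h ha hh hcpQ rfl).2.2).symm

/-- **PINNING IS FREE.** If `e(hcp a h) = e*` then `(a, h)` is a global minimiser of `hcpE` over the open
quadrant (`e* ≤ e(hcp a' h') = hcpE a' h'`, `ciInf_le crysPeriodicBddBelow_proof`). [folklore] -/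
theorem hcpE_globalMin_of_energy_eq_eStar {a h : ℝ} (ha : a ≠ 0) (hh : h ≠ 0)
    (hE : (hcpPeriodicConfiguration ha hh).energyPerParticle lennardJones =
      ⨅ Q : PeriodicConfiguration 3, Q.energyPerParticle lennardJones) :
    ∀ a' h' : ℝ, 0 < a' → 0 < h' → hcpE a h ≤ hcpE a' h' := by
  intro a' h' ha' hh'
  rw [hcpE_eq_energyPerParticle ha hh, hE, hcpE_eq_energyPerParticle ha'.ne' hh'.ne']
  exact ciInf_le Summit.AtomisticToContinuum.Crystallization.Theorems.crysPeriodicBddBelow_proof _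

/-- **Measure-level K2 with slack, from the two cruxes and the landed stubs**: `PalmRigidity` (from
`MinimiserShells`, `ShellsToBarlowChart_of`, `LayeredLawsSelectHcp`, glue `cruxesToPalmRigidity_proof`) makes a.e. sample of a
minimising law a rotated `hcp(a, h)` with `e(hcp a h) = e*`; pinning is free; the certificate puts the two
bond lengths in the box with slack `σ₀`; the root geometry gives K2 with slack `min σ₀ (1/100)` at the root, a.s. [folklore] -/
theorem minimisingLawsTwelveWithin_of_stubs (hShells : MinimiserShells) (hSelect : LayeredLawsSelectHcp)
    {σ₀ : ℝ} (hσ₀ : 0 < σ₀)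
    (hCert : ∀ a h : ℝ, 0 < a → 0 < h →
      (∀ a' h' : ℝ, 0 < a' → 0 < h' → hcpE a h ≤ hcpE a' h') →
      55 / 57 + σ₀ ≤ a ∧ a ≤ 1 - σ₀ ∧
        55 / 57 + σ₀ ≤ Real.sqrt (a ^ 2 / 3 + h ^ 2) ∧ Real.sqrt (a ^ 2 / 3 + h ^ 2) ≤ 1 - σ₀) :
    ∀ δ : ℝ, 0 < δ → ∀ P : Measure (Measure (EuclideanSpace ℝ (Fin 3))), IsProbabilityMeasure P →
      (∀ᵐ μ ∂P, (∃ S : Set (EuclideanSpace ℝ (Fin 3)), (0 : EuclideanSpace ℝ (Fin 3)) ∈ S ∧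
        (∀ x ∈ S, ∀ y ∈ S, x ≠ y → δ ≤ dist x y) ∧
        μ = (Measure.count : Measure (EuclideanSpace ℝ (Fin 3))).restrict S)) →
      (∀ g : Measure (EuclideanSpace ℝ (Fin 3)) → EuclideanSpace ℝ (Fin 3) → ℝ≥0∞,
        Measurable (Function.uncurry g) →
        ∫⁻ μ, ∫⁻ y, g μ y ∂μ ∂P = ∫⁻ μ, ∫⁻ y, g (Measure.map (fun z => z - y) μ) (-y) ∂μ ∂P) →
      (∫ μ, (∫ y, lennardJones ‖y‖ ∂μ) / 2 ∂P) ≤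
        (⨅ Q : PeriodicConfiguration 3, Q.energyPerParticle lennardJones) →
      ∀ᵐ μ ∂P,
        (∀ w : EuclideanSpace ℝ (Fin 3), μ {w} ≠ 0 → ‖w‖ ≤ 11 / 10 + min σ₀ (1 / 100) →
            ∀ w' : EuclideanSpace ℝ (Fin 3), μ {w'} ≠ 0 → w' ≠ w → 55 / 57 + min σ₀ (1 / 100) ≤ dist w w') ∧
          ∃ T : Finset (EuclideanSpace ℝ (Fin 3)), T.card = 12 ∧
            ∀ w ∈ T, μ {w} ≠ 0 ∧ w ≠ 0 ∧ ‖w‖ ≤ 1 - min σ₀ (1 / 100) := by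
  intro δ hδ P hP hcore hstat hmin
  have hPalm : PalmRigidity :=
    Summit.AtomisticToContinuum.Crystallization.Theorems.PalmUnimodularRigidity.cruxesToPalmRigidity_proof hShells
      Summit.AtomisticToContinuum.Crystallization.Cruxes.ShellsToBarlowChart.DevelopTheModelGrowthDescent.ShellsToBarlowChart_of
      hSelect
  have hae := hPalm δ hδ P hP hcore hstat hmin
  filter_upwards [hae] with μ hμ
  obtain ⟨a, h, ha, hh, ha1, -, hh1, -, A, hE, rfl⟩ := hμ
  have hapos : 0 < a := by linarith
  have hhpos : 0 < h := by linarith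
  obtain ⟨hb1, hb2, hb3, hb4⟩ := hCert a h hapos hhpos (hcpE_globalMin_of_energy_eq_eStar ha hh hE)
  set σ := min σ₀ (1 / 100) with hσ_def
  have hσpos : 0 < σ := lt_min hσ₀ (by norm_num)
  have hσle : σ ≤ 1 / 100 := min_le_right _ _
  have hσle' : σ ≤ σ₀ := min_le_left _ _
  exact stub_hcpRootGeometry σ a h hσpos hσle (by linarith) (by linarith) (by linarith) (by linarith)
    hhpos A

/-! ## The crux from the two shared open cruxes -/

/-- **`TwelveWithinOne` FROM `MinimiserShells ∧ LayeredLawsSelectHcp`** (items stmt-AtomisticToContinuum-9225 and -9226 of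
route `PalmUnimodularRigidity`, the only open inputs): the certificate and the root geometry give measure-level K2
with slack `σ = min σ₀ (1/100) > 0`; `stub_return` and `stub_bsLimitAlong` return it to every sequence of ground
states.  CONDITIONAL on the two cruxes — it credits K2 nothing until they land. -/
theorem twelveWithinOne_of_palmCruxes (hShells : MinimiserShells) (hSelect : LayeredLawsSelectHcp) :
    Summit.AtomisticToContinuum.Crystallization.Theses.SquareWellLayerCake.TwelveWithinOne := by
  obtain ⟨σ₀, hσ₀, hCert⟩ := stub_hcpCellCertificate
  have hLaws := minimisingLawsTwelveWithin_of_stubs hShells hSelect hσ₀ hCert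
  unfold Summit.AtomisticToContinuum.Crystallization.Theses.SquareWellLayerCake.TwelveWithinOne
  exact stub_return (min σ₀ (1 / 100)) (lt_min hσ₀ (by norm_num)) hLaws stub_bsLimitAlong

end Summit.AtomisticToContinuum.Crystallization.Theorems.SquareWellLayerCakeTwelveWithinOne.Closing

end
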